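import Mathlib
import Literature.NumberTheory.Transcendental.SemialgebraicMaps
import Summits.KontsevichZagierPeriods.KontsevichZagierPeriods.Theorems.SoloInformedRatJacobian
import Summits.KontsevichZagierPeriods.KontsevichZagierPeriods.Theorems.SoloInformedHalfAngle
import HarnessLib
import HarnessLib.Audit

/-!
# SoloInformed — the Calabi change of variables in rational half-angle coordinates

Geometry for Euler's identity `ζ(2) = π²/6` inside the Kontsevich–Zagier four-move calculus
(`SoloInformedZetaTwo`). Calabi's substitution `(x, y) = (sin u / cos v, sin v / cos u)`
[Beukers–Calabi–Kolk, *Sums of generalized harmonic series and volumes*, Nieuw Arch. Wisk. (4) 11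
(1993) 217–224] maps the triangle `{u, v > 0, u + v < π/2}` diffeomorphically onto the open unit
square with Jacobian `1 − x²y²`. It is transcendental, hence not a move of the calculus; but in the
Weierstrass half-angle coordinates `a = tan(u/2)`, `b = tan(v/2)` it becomes the RATIONAL map

  `Ψ(a, b) = (S(a)/C(b), S(b)/C(a))`,  `S(t) = 2t/(1+t²)`, `C(t) = (1−t²)/(1+t²)`,

defined over `ℚ`, a bijection from the semialgebraic triangle `T = {a, b > 0, a + b + ab < 1}` onto
`(0,1)²`, with `det Ψ' = 4(1 − x²y²)/((1+a²)(1+b²))`. This file proves exactly the hypotheses that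
rule (2) (`KZ.changeOfVariablesRel`) asks of `Ψ` (semialgebraicity and the derivative come from
`SoloInformedRatJacobian`): the determinant formula, injectivity and surjectivity onto the open
square (inverse by explicit half-angle formulas), together with the Möbius involution
`σ(a, b) = ((1−a)/(1+a), (1−b)/(1+b))` (`= tan(π/4 − ·/2)`) exchanging `T` with the co-triangle
`T' = (0,1)² ∩ {a + b + ab > 1}`.

Residency `solo-KontsevichZagierPeriods-informed` (PLAN.md, session s17).
-/

noncomputable section

namespace Summit.KontsevichZagierPeriods.KontsevichZagierPeriods.Theorems

open Literature.NumberTheory.Transcendental MvPolynomial Set MeasureTheory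

/-! ### The Calabi map `Ψ(a,b) = (S(a)/C(b), S(b)/C(a))` -/

/-- Numerators of the Calabi map. -/
def soloInformedCalabiP : Fin 2 → MvPolynomial (Fin 2) ℚ :=
  ![C 2 * X 0 * (1 + X 1 ^ 2), C 2 * X 1 * (1 + X 0 ^ 2)]

/-- Denominators of the Calabi map. -/
def soloInformedCalabiQ : Fin 2 → MvPolynomial (Fin 2) ℚ :=
  ![(1 + X 0 ^ 2) * (1 - X 1 ^ 2), (1 + X 1 ^ 2) * (1 - X 0 ^ 2)]

/-- **The Calabi map** `Ψ(a, b) = (2a(1+b²)/((1+a²)(1−b²)), 2b(1+a²)/((1+b²)(1−a²)))`, the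
half-angle-rational form of `(u, v) ↦ (sin u / cos v, sin v / cos u)`
[Beukers–Calabi–Kolk 1993]. -/
def soloInformedCalabi : (Fin 2 → ℝ) → (Fin 2 → ℝ) :=
  soloInformedRatMap soloInformedCalabiP soloInformedCalabiQ

/-- First component of the Calabi map. -/
@[simp] theorem soloInformedCalabi_apply_zero (u : Fin 2 → ℝ) :
    soloInformedCalabi u 0 = 2 * u 0 * (1 + u 1 ^ 2) / ((1 + u 0 ^ 2) * (1 - u 1 ^ 2)) := by
  simp [soloInformedCalabi, soloInformedCalabiP, soloInformedCalabiQ]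

/-- Second component of the Calabi map. -/
@[simp] theorem soloInformedCalabi_apply_one (u : Fin 2 → ℝ) :
    soloInformedCalabi u 1 = 2 * u 1 * (1 + u 0 ^ 2) / ((1 + u 1 ^ 2) * (1 - u 0 ^ 2)) := by
  simp [soloInformedCalabi, soloInformedCalabiP, soloInformedCalabiQ]

/-- First component of the Calabi map as `S(a)/C(b)`. -/
theorem soloInformedCalabi_zero_eq (u : Fin 2 → ℝ) :
    soloInformedCalabi u 0 = soloInformedHS (u 0) / soloInformedHC (u 1) := by
  rw [soloInformedCalabi_apply_zero, soloInformedHS, soloInformedHC, div_div_div_eq]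

/-- Second component of the Calabi map as `S(b)/C(a)`. -/
theorem soloInformedCalabi_one_eq (u : Fin 2 → ℝ) :
    soloInformedCalabi u 1 = soloInformedHS (u 1) / soloInformedHC (u 0) := by
  rw [soloInformedCalabi_apply_one, soloInformedHS, soloInformedHC, div_div_div_eq]

/-- The denominators of the Calabi map do not vanish on `[0,1)²`. -/
theorem soloInformed_calabiQ_ne_zero {u : Fin 2 → ℝ} (h0 : u 0 < 1) (h0' : 0 ≤ u 0) (h1 : u 1 < 1)
    (h1' : 0 ≤ u 1) (j : Fin 2) : (aeval u (soloInformedCalabiQ j) : ℝ) ≠ 0 := by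
  have ha : 0 < 1 - u 0 ^ 2 := by nlinarith
  have hb : 0 < 1 - u 1 ^ 2 := by nlinarith
  fin_cases j
  · simp [soloInformedCalabiQ]; exact ⟨by positivity, hb.ne'⟩
  · simp [soloInformedCalabiQ]; exact ⟨by positivity, ha.ne'⟩

/-- **Jacobian determinant of the Calabi map**:
`det Ψ'(a,b) = 4(1 − x²y²)/((1+a²)(1+b²))` with `(x, y) = Ψ(a, b)`. -/
theorem soloInformed_det_calabi (u : Fin 2 → ℝ) (ha : 1 - u 0 ^ 2 ≠ 0) (hb : 1 - u 1 ^ 2 ≠ 0) :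
    (soloInformedRatJacCLM soloInformedCalabiP soloInformedCalabiQ u).det =
      4 / ((1 + u 0 ^ 2) * (1 + u 1 ^ 2)) *
        (1 - (soloInformedCalabi u 0 * soloInformedCalabi u 1) ^ 2) := by
  have ha' : (1 + u 0 ^ 2) ≠ 0 := by positivity
  have hb' : (1 + u 1 ^ 2) ≠ 0 := by positivity
  rw [soloInformed_det_ratJacCLM, Matrix.det_fin_two]
  simp only [Matrix.of_apply, soloInformedRatJacEntry, soloInformedCalabiP, soloInformedCalabiQ,
    soloInformedCalabi_apply_zero, soloInformedCalabi_apply_one]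
  simp [pderiv_X]
  field_simp
  ring

/-- `Ψ` maps the Calabi triangle into the open square. -/
theorem soloInformed_calabi_mem_openSq {u : Fin 2 → ℝ} (hu : u ∈ soloInformedCalabiSrc) :
    soloInformedCalabi u ∈ soloInformedOpenSq := by
  obtain ⟨h0, h1, h⟩ := hu
  obtain ⟨h0', h1'⟩ := soloInformed_lt_one_of_mem_calabiSrc ⟨h0, h1, h⟩
  rw [soloInformed_mem_openSq, soloInformedCalabi_zero_eq, soloInformedCalabi_one_eq]
  have hSa := soloInformed_hS_pos h0
  have hSb := soloInformed_hS_pos h1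
  have hCa := soloInformed_hC_pos h0.le h0'
  have hCb := soloInformed_hC_pos h1.le h1'
  refine ⟨⟨div_pos hSa hCb, (div_lt_one hCb).2 ((soloInformed_hS_lt_hC_iff h0 h0' h1.le).2 h)⟩,
    div_pos hSb hCa, (div_lt_one hCa).2 ((soloInformed_hS_lt_hC_iff h1 h1' h0.le).2 (by linarith))⟩

/-- Recovering `sin² u` from `(x, y) = (sin u/cos v, sin v/cos u)`:
`x²(1 − y²) = sin²u · (1 − x²y²)`. -/
theorem soloInformed_halfRecover {s₁ c₁ s₂ c₂ : ℝ} (h₁ : s₁ ^ 2 + c₁ ^ 2 = 1)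
    (h₂ : s₂ ^ 2 + c₂ ^ 2 = 1) (hc₁ : c₁ ≠ 0) (hc₂ : c₂ ≠ 0) :
    (s₁ / c₂) ^ 2 * (1 - (s₂ / c₁) ^ 2) = s₁ ^ 2 * (1 - (s₁ / c₂ * (s₂ / c₁)) ^ 2) := by
  field_simp
  linear_combination (-(s₁ ^ 2 * c₁ ^ 2)) * h₂ + (s₁ ^ 2 * s₂ ^ 2) * h₁

/-- `Ψ` is injective on the Calabi triangle. -/
theorem soloInformed_calabi_injOn : InjOn soloInformedCalabi soloInformedCalabiSrc := by
  intro u hu v hv huv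
  obtain ⟨hu0', hu1'⟩ := soloInformed_lt_one_of_mem_calabiSrc hu
  obtain ⟨hv0', hv1'⟩ := soloInformed_lt_one_of_mem_calabiSrc hv
  have hsq' := soloInformed_calabi_mem_openSq hv
  obtain ⟨hu0, hu1, -⟩ := hu
  obtain ⟨hv0, hv1, -⟩ := hv
  have hx := congr_fun huv 0
  have hy := congr_fun huv 1
  rw [soloInformedCalabi_zero_eq, soloInformedCalabi_zero_eq] at hx
  rw [soloInformedCalabi_one_eq, soloInformedCalabi_one_eq] at hy
  have hCua := soloInformed_hC_pos hu0.le hu0'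
  have hCub := soloInformed_hC_pos hu1.le hu1'
  have hCva := soloInformed_hC_pos hv0.le hv0'
  have hCvb := soloInformed_hC_pos hv1.le hv1'
  -- sin² u is determined by (x, y)
  have ru := soloInformed_halfRecover (soloInformed_hS_sq_add_hC_sq (u 0))
    (soloInformed_hS_sq_add_hC_sq (u 1)) hCua.ne' hCub.ne'
  have rv := soloInformed_halfRecover (soloInformed_hS_sq_add_hC_sq (v 0))
    (soloInformed_hS_sq_add_hC_sq (v 1)) hCva.ne' hCvb.ne'
  rw [hx, hy] at ru
  have hD : 0 < 1 - (soloInformedHS (v 0) / soloInformedHC (v 1) *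
      (soloInformedHS (v 1) / soloInformedHC (v 0))) ^ 2 := by
    rw [soloInformed_mem_openSq, soloInformedCalabi_zero_eq, soloInformedCalabi_one_eq] at hsq'
    obtain ⟨⟨hx0, hx1⟩, hy0, hy1⟩ := hsq'
    have : soloInformedHS (v 0) / soloInformedHC (v 1) * (soloInformedHS (v 1) / soloInformedHC (v 0)) < 1 :=
      by nlinarith
    nlinarith [mul_pos hx0 hy0]
  have hS2 : soloInformedHS (u 0) ^ 2 = soloInformedHS (v 0) ^ 2 := by
    have := ru.symm.trans rv
    exact mul_right_cancel₀ hD.ne' this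
  have hSa : soloInformedHS (u 0) = soloInformedHS (v 0) := by
    have := (sq_eq_sq₀ (soloInformed_hS_pos hu0).le (soloInformed_hS_pos hv0).le).1 hS2
    exact this
  have ha : u 0 = v 0 := soloInformed_hS_inj hu0 hu0' hv0 hv0' hSa
  -- then sin v from y
  have hSb : soloInformedHS (u 1) = soloInformedHS (v 1) := by
    rw [ha] at hy
    field_simp at hy
    linarith [hy]
  have hb : u 1 = v 1 := soloInformed_hS_inj hu1 hu1' hv1 hv1' hSb
  funext i; fin_cases i
  · exact ha
  · exact hb

/-- `Ψ` maps the Calabi triangle ONTO the open square (inverse by half-angles: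
`cos u = √((1−x²)/(1−x²y²))`, `sin u = x cos v`, `a = sin u/(1 + cos u)`). -/
theorem soloInformed_calabi_surjOn : SurjOn soloInformedCalabi soloInformedCalabiSrc soloInformedOpenSq := by
  intro x hx
  rw [soloInformed_mem_openSq] at hx
  obtain ⟨⟨hp0, hp1⟩, hq0, hq1⟩ := hx
  set p := x 0 with hp
  set q := x 1 with hq
  have hpq : p * q < 1 := by nlinarith
  have hD : 0 < 1 - p ^ 2 * q ^ 2 := by nlinarith [mul_pos hp0 hq0]
  set cu := Real.sqrt ((1 - p ^ 2) / (1 - p ^ 2 * q ^ 2)) with hcu_def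
  set cv := Real.sqrt ((1 - q ^ 2) / (1 - p ^ 2 * q ^ 2)) with hcv_def
  have hcu : 0 < cu := Real.sqrt_pos.2 (div_pos (by nlinarith) hD)
  have hcv : 0 < cv := Real.sqrt_pos.2 (div_pos (by nlinarith) hD)
  have hcu2 : cu ^ 2 = (1 - p ^ 2) / (1 - p ^ 2 * q ^ 2) :=
    Real.sq_sqrt (div_pos (by nlinarith) hD).le
  have hcv2 : cv ^ 2 = (1 - q ^ 2) / (1 - p ^ 2 * q ^ 2) :=
    Real.sq_sqrt (div_pos (by nlinarith) hD).le
  set su := p * cv with hsu_def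
  set sv := q * cu with hsv_def
  have hpy1 : su ^ 2 + cu ^ 2 = 1 := by
    rw [hsu_def, mul_pow, hcv2, hcu2, mul_div_assoc', ← add_div, div_eq_one_iff_eq hD.ne']
    ring
  have hpy2 : sv ^ 2 + cv ^ 2 = 1 := by
    rw [hsv_def, mul_pow, hcv2, hcu2, mul_div_assoc', ← add_div, div_eq_one_iff_eq hD.ne']
    ring
  have hsu : 0 < su := mul_pos hp0 hcv
  have hsv : 0 < sv := mul_pos hq0 hcu
  have hsu1 : su ≤ 1 := by nlinarith [sq_nonneg cu]
  have hsv1 : sv ≤ 1 := by nlinarith [sq_nonneg cv]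
  set a := su / (1 + cu) with ha_def
  set b := sv / (1 + cv) with hb_def
  obtain ⟨hSa, hCa⟩ := soloInformed_halfAngle hpy1 (by linarith)
  obtain ⟨hSb, hCb⟩ := soloInformed_halfAngle hpy2 (by linarith)
  rw [← ha_def] at hSa hCa
  rw [← hb_def] at hSb hCb
  have ha0 : 0 < a := div_pos hsu (by linarith)
  have hb0 : 0 < b := div_pos hsv (by linarith)
  have ha1 : a < 1 := (div_lt_one (by linarith)).2 (by linarith)
  have hb1 : b < 1 := (div_lt_one (by linarith)).2 (by linarith)
  refine ⟨![a, b], ⟨by simpa using ha0, by simpa using hb0, ?_⟩, ?_⟩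
  · show (![a, b] : Fin 2 → ℝ) 0 + (![a, b] : Fin 2 → ℝ) 1 + (![a, b] : Fin 2 → ℝ) 0 * (![a, b] : Fin 2 → ℝ) 1 < 1
    simp only [Matrix.cons_val_zero, Matrix.cons_val_one]
    rw [← soloInformed_hS_lt_hC_iff ha0 ha1 hb0.le, hSa, hCb, hsu_def]
    exact mul_lt_of_lt_one_left hcv hp1
  · funext i
    fin_cases i
    · simp only [Fin.zero_eta]
      rw [soloInformedCalabi_zero_eq]
      simp only [Matrix.cons_val_zero, Matrix.cons_val_one]
      rw [hSa, hCb, hsu_def, mul_div_cancel_right₀ _ hcv.ne']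
    · simp only [Fin.mk_one]
      rw [soloInformedCalabi_one_eq]
      simp only [Matrix.cons_val_zero, Matrix.cons_val_one]
      rw [hSb, hCa, hsv_def, mul_div_cancel_right₀ _ hcu.ne']

/-- **`Ψ(T) = (0,1)²`.** -/
theorem soloInformed_calabi_image :
    soloInformedCalabi '' soloInformedCalabiSrc = soloInformedOpenSq := by
  refine Set.Subset.antisymm ?_ soloInformed_calabi_surjOn
  rintro _ ⟨u, hu, rfl⟩
  exact soloInformed_calabi_mem_openSq hu

/-! ### The Möbius involution `σ(a,b) = ((1−a)/(1+a), (1−b)/(1+b))` (`= (tan(π/4 − u/2), …)`) -/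

/-- Numerators of `σ`. -/
def soloInformedMoebP : Fin 2 → MvPolynomial (Fin 2) ℚ := ![1 - X 0, 1 - X 1]

/-- Denominators of `σ`. -/
def soloInformedMoebQ : Fin 2 → MvPolynomial (Fin 2) ℚ := ![1 + X 0, 1 + X 1]

/-- The Möbius involution `σ`. -/
def soloInformedMoeb : (Fin 2 → ℝ) → (Fin 2 → ℝ) := soloInformedRatMap soloInformedMoebP soloInformedMoebQ

/-- First component of `σ`. -/
@[simp] theorem soloInformedMoeb_apply_zero (u : Fin 2 → ℝ) :
    soloInformedMoeb u 0 = (1 - u 0) / (1 + u 0) := by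
  simp [soloInformedMoeb, soloInformedMoebP, soloInformedMoebQ]

/-- Second component of `σ`. -/
@[simp] theorem soloInformedMoeb_apply_one (u : Fin 2 → ℝ) :
    soloInformedMoeb u 1 = (1 - u 1) / (1 + u 1) := by
  simp [soloInformedMoeb, soloInformedMoebP, soloInformedMoebQ]

/-- The denominators of `σ` do not vanish on `[0, ∞)²`. -/
theorem soloInformed_moebQ_ne_zero {u : Fin 2 → ℝ} (h0 : 0 ≤ u 0) (h1 : 0 ≤ u 1) (j : Fin 2) :
    (aeval u (soloInformedMoebQ j) : ℝ) ≠ 0 := by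
  fin_cases j
  · simp [soloInformedMoebQ]; linarith
  · simp [soloInformedMoebQ]; linarith

/-- `det σ'(a,b) = 4/((1+a)²(1+b)²)`. -/
theorem soloInformed_det_moeb (u : Fin 2 → ℝ) (ha : 1 + u 0 ≠ 0) (hb : 1 + u 1 ≠ 0) :
    (soloInformedRatJacCLM soloInformedMoebP soloInformedMoebQ u).det =
      4 / ((1 + u 0) ^ 2 * (1 + u 1) ^ 2) := by
  rw [soloInformed_det_ratJacCLM, Matrix.det_fin_two]
  simp only [Matrix.of_apply, soloInformedRatJacEntry, soloInformedMoebP, soloInformedMoebQ]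
  simp [pderiv_X]
  field_simp
  ring

/-- The Möbius coordinate `m(t) = (1−t)/(1+t)` maps `(0,1)` to `(0,1)`. -/
theorem soloInformed_moeb_coord_mem {t : ℝ} (h0 : 0 < t) (h1 : t < 1) :
    0 < (1 - t) / (1 + t) ∧ (1 - t) / (1 + t) < 1 :=
  ⟨div_pos (by linarith) (by linarith), (div_lt_one (by linarith)).2 (by linarith)⟩

/-- The triangle inequality under `σ`: `m(a) + m(b) + m(a)m(b) = (3 − a − b − ab)/((1+a)(1+b))`. -/
theorem soloInformed_moeb_sum (a b : ℝ) (ha : 1 + a ≠ 0) (hb : 1 + b ≠ 0) :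
    (1 - a) / (1 + a) + (1 - b) / (1 + b) + (1 - a) / (1 + a) * ((1 - b) / (1 + b)) =
      (3 - a - b - a * b) / ((1 + a) * (1 + b)) := by
  field_simp
  ring

/-- `σ` is an involution on `[0, ∞)²`. -/
theorem soloInformed_moeb_moeb {u : Fin 2 → ℝ} (h0 : 0 ≤ u 0) (h1 : 0 ≤ u 1) :
    soloInformedMoeb (soloInformedMoeb u) = u := by
  have key : ∀ t : ℝ, 1 + t ≠ 0 → (1 - (1 - t) / (1 + t)) / (1 + (1 - t) / (1 + t)) = t :=
    fun t h => by field_simp; ring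
  funext i
  fin_cases i
  · simp only [Fin.zero_eta, soloInformedMoeb_apply_zero]
    exact key _ (by linarith)
  · simp only [Fin.mk_one, soloInformedMoeb_apply_one]
    exact key _ (by linarith)

/-- `σ` maps the co-triangle into the triangle. -/
theorem soloInformed_moeb_mem_src {u : Fin 2 → ℝ} (hu : u ∈ soloInformedCalabiCo) :
    soloInformedMoeb u ∈ soloInformedCalabiSrc := by
  obtain ⟨⟨h0, h0'⟩, ⟨h1, h1'⟩, h⟩ := hu
  refine ⟨by simpa using (soloInformed_moeb_coord_mem h0 h0').1,
    by simpa using (soloInformed_moeb_coord_mem h1 h1').1, ?_⟩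
  simp only [soloInformedMoeb_apply_zero, soloInformedMoeb_apply_one]
  rw [soloInformed_moeb_sum _ _ (by linarith) (by linarith),
    div_lt_one (by positivity)]
  nlinarith

/-- `σ` maps the triangle into the co-triangle. -/
theorem soloInformed_moeb_mem_co {u : Fin 2 → ℝ} (hu : u ∈ soloInformedCalabiSrc) :
    soloInformedMoeb u ∈ soloInformedCalabiCo := by
  obtain ⟨h0', h1'⟩ := soloInformed_lt_one_of_mem_calabiSrc hu
  obtain ⟨h0, h1, h⟩ := hu
  refine ⟨by simpa using soloInformed_moeb_coord_mem h0 h0',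
    by simpa using soloInformed_moeb_coord_mem h1 h1', ?_⟩
  simp only [soloInformedMoeb_apply_zero, soloInformedMoeb_apply_one]
  rw [soloInformed_moeb_sum _ _ (by linarith) (by linarith),
    one_lt_div (by positivity)]
  nlinarith

/-- `σ` is injective on the co-triangle. -/
theorem soloInformed_moeb_injOn : InjOn soloInformedMoeb soloInformedCalabiCo := by
  intro u hu v hv huv
  rw [← soloInformed_moeb_moeb hu.1.1.le hu.2.1.1.le, ← soloInformed_moeb_moeb hv.1.1.le hv.2.1.1.le,
    huv]

/-- **`σ(T') = T`.** -/
theorem soloInformed_moeb_image :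
    soloInformedMoeb '' soloInformedCalabiCo = soloInformedCalabiSrc := by
  refine Set.Subset.antisymm ?_ fun w hw =>
    ⟨soloInformedMoeb w, soloInformed_moeb_mem_co hw, soloInformed_moeb_moeb hw.1.le hw.2.1.le⟩
  rintro _ ⟨u, hu, rfl⟩
  exact soloInformed_moeb_mem_src hu

end Summit.KontsevichZagierPeriods.KontsevichZagierPeriods.Theorems
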